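import Summits.AtomisticToContinuum.FouriersLaw.Theorems.LocalOhmBVLocalOhmReduction
import Summits.AtomisticToContinuum.FouriersLaw.Theorems.LocalOhmBVLocalOhmStubSoftExtractionWeakSqrt
import Summits.AtomisticToContinuum.FouriersLaw.Theorems.LocalOhmBVLocalOhmStubNoUnitCurrentOfZeroDrudeVar

/-!
# `LocalOhm` reduced to the interior LTE estimate at the CLT scale and variational zero current Drude weight

Crux item stmt-AtomisticToContinuum-12009 (`Summit.AtomisticToContinuum.FouriersLaw.Theses.LocalOhmBV.LocalOhm`, shared verbatim with
`…Theses.TransferKernelPositivity.LocalOhm`), line `registered` (birth), skeleton v10 of lead c5 (2026-08-17). This file is the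
SORRY-FREE part of the reshaped skeleton (`Cruxes/LocalOhm/Lines/birth.lean`): everything except the two stubs of open-problem strength,
which appear here as HYPOTHESES (spelled out, not named):

* (S1♯) the `N`-uniform interior linearised-LTE estimate at the CLT scale (`stub_linearisedLTESharp` of the skeleton): on bulk windows the
  first-order NESS response of a window observable is `θ(x) · Cov_{μ_{N,T,T}}(ψ, H_N)/T²` up to
  `A √(ℓ+1) ‖ψ‖_{L²(μ_{N,T,T})} (|d|/(N-1) + WV_x(ℓ))`, ONE constant `A` for all radii `ℓ`;
* (VZD) variational zero current Drude weight in the odd sector (`stub_zeroDrudeVar`): for the shift-invariant Gibbs state `μ_T` of the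
  infinite chain and every `ε > 0` there are local `G` (`C¹`) and momentum-even `E` with
  `∫ (Σ_{x≤M} [j_x − 𝒜(G ∘ box_{a+x,n}) − E ∘ box_{a+x,n}])² dμ_T ≤ ε (M+1)` for arbitrarily large `M` — `inf ‖j_0 − 𝒜G − E‖_{ℋ₀} = 0`,
  a statement about `μ_T` alone.

Compared with the c4 reduction `localOhm_of_linearisedLTE_of_oddSectorLiouvilleSym` (`…LocalOhmReduction.lean`, p159151: (S1) → (S3) →
`LocalOhm` with S3 = rigidity for functionals of ARBITRARY box growth): S1♯ fixes the growth of S1's constant at its forced scale `√(ℓ+1)`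
(attained at the harmonic corner, evidence S1SHARP-CALIBRATION.md), which puts the extracted functional in the `√n`-regular class
(`stub_softExtractionWeakSqrt`, p162063), and in that class the rigidity input is the dynamics-free, functional-free VZD
(bridge `stub_noUnitCurrent_of_zeroDrudeVar`, p163112) — the completeness excess of S3 is gone.

What is PROVED here (no `sorry`, standard axioms):
* `blowUpLimitSqrt` — the extraction in the `√n` class is unconditional given (S1♯): every violating sequence yields a shift-invariant Gibbs
  state `μinf` and a linear, `√n`-regular, `liouvilleZ`-invariant functional with unit current on every bond;
* `localOhm_of_linearisedLTESharp_of_zeroDrudeVar` — **(S1♯) → (VZD) → `LocalOhmBV.LocalOhm`**;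
* `transferKernelPositivity_localOhm_of_linearisedLTESharp_of_zeroDrudeVar` — the same for the shared copy.
Nothing here closes the item: (S1♯) has no `N`-uniform source (BLR2000 §7) and (VZD) is zero current Drude weight (false at `lam = β = 0`).
-/

set_option autoImplicit false

noncomputable section

namespace Summit.AtomisticToContinuum.FouriersLaw.Theorems.LocalOhmBirth

open MeasureTheory Filter Topology
open scoped BigOperators
open Literature.MathematicalPhysics.KineticTheory.HeatConduction
open Summit.AtomisticToContinuum.FouriersLaw.Theses.LocalOhmBV (LocalOhm)
open Summit.AtomisticToContinuum.FouriersLaw.Theorems.WindowLimit (embed)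

/-- **`blowUpLimitSqrt` — the extraction of the birth line in the `√n` class is unconditional.** In the frame of `LocalOhm`
(parameters `> 0`, weak-NESS uniqueness, a steady-state family `μ`, `T > 0`), GIVEN the interior a-priori estimate at the CLT scale
(A♯) (= stub S1♯, as a hypothesis) and a violating sequence `(N_k, d_k, θ_k, x_k)`, there are a shift-invariant Gibbs state `μinf` of the
infinite chain and a functional `Λ` which is (1) linear on continuous polynomially bounded cylinder pairs, (2♯) `√n`-regular
(`|Λ(g ∘ box_{a,n})| ≤ A √(n+1) ‖g ∘ box_{a,n}‖_{L²(μinf)}`), (3) `liouvilleZ`-invariant, (4) of unit current on every bond. Composition of the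
landed `stub_finiteResponsePackage`, `equilibriumPackageWeak` and `stub_softExtractionWeakSqrt`. [folklore] -/
theorem blowUpLimitSqrt :
    ∀ ω₂ lam β γ : ℝ, 0 < ω₂ → 0 < lam → 0 < β → 0 < γ →
    (∀ (N : ℕ) (T_L T_R : ℝ), 0 < T_L → 0 < T_R → ∀ μ ν : Measure (PhaseSpace N),
      (pinnedChain ω₂ lam β γ).IsSteadyState N T_L T_R μ →
      (pinnedChain ω₂ lam β γ).IsSteadyState N T_L T_R ν → μ = ν) →
    ∀ μ : (N : ℕ) → ℝ → ℝ → Measure (PhaseSpace N),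
    (∀ (N : ℕ) (T_L T_R : ℝ), 0 < T_L → 0 < T_R →
      (pinnedChain ω₂ lam β γ).IsSteadyState N T_L T_R (μ N T_L T_R)) →
    ∀ T : ℝ, 0 < T →
    (∃ A : ℝ, ∀ ℓ : ℕ, ∃ b : ℕ, ∀ (N : ℕ) (d : ℝ) (θ : Fin N → ℝ),
      Tendsto (fun δ : ℝ => (pinnedChain ω₂ lam β γ).totalCurrent (μ N (T + δ / 2) (T - δ / 2)) / δ)
        (𝓝[≠] 0) (𝓝 d) →
      (∀ i : Fin N, Tendsto (fun δ : ℝ => ((∫ x, (x.2 i) ^ 2 ∂(μ N (T + δ / 2) (T - δ / 2))) -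
        ∫ x, (x.2 i) ^ 2 ∂(μ N T T)) / δ) (𝓝[≠] 0) (𝓝 (θ i))) →
      ∀ x : ℕ, b + ℓ ≤ x → x + ℓ + b + 2 ≤ N →
      ∀ ψ : PhaseSpace N → ℝ, Continuous ψ →
        (∀ z z' : PhaseSpace N, (∀ i : Fin N, x ≤ i.val + ℓ → i.val ≤ x + ℓ + 1 →
          z.1 i = z'.1 i ∧ z.2 i = z'.2 i) → ψ z = ψ z') →
        (∃ (C₀ : ℝ) (m : ℕ), ∀ z, |ψ z| ≤ C₀ * (1 + ‖z‖) ^ m) →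
        ∀ ρ : ℝ, Tendsto (fun δ : ℝ => ((∫ z, ψ z ∂(μ N (T + δ / 2) (T - δ / 2))) -
          ∫ z, ψ z ∂(μ N T T)) / δ) (𝓝[≠] 0) (𝓝 ρ) →
        |ρ - (∑ i : Fin N, if i.val = x then θ i else 0) *
            (((∫ z, ψ z * (pinnedChain ω₂ lam β γ).hamiltonian N z ∂(μ N T T)) -
              (∫ z, ψ z ∂(μ N T T)) * (∫ z, (pinnedChain ω₂ lam β γ).hamiltonian N z ∂(μ N T T))) /
              T ^ 2)| ≤
          A * Real.sqrt ((ℓ : ℝ) + 1) * Real.sqrt (∫ z, (ψ z) ^ 2 ∂(μ N T T)) *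
            (|d| / ((N : ℝ) - 1) + ∑ i : Fin N, ∑ j : Fin N,
              (if j.val = i.val + 1 ∧ x ≤ i.val + ℓ ∧ i.val ≤ x + ℓ then |θ j - θ i| else 0))) →
    ∀ (Nk : ℕ → ℕ) (dk : ℕ → ℝ) (θk : (k : ℕ) → Fin (Nk k) → ℝ) (xk : ℕ → ℕ),
    (∀ k : ℕ, Tendsto (fun δ : ℝ =>
        (pinnedChain ω₂ lam β γ).totalCurrent (μ (Nk k) (T + δ / 2) (T - δ / 2)) / δ) (𝓝[≠] 0) (𝓝 (dk k))) →
    (∀ (k : ℕ) (i : Fin (Nk k)), Tendsto (fun δ : ℝ =>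
        ((∫ x, (x.2 i) ^ 2 ∂(μ (Nk k) (T + δ / 2) (T - δ / 2))) - ∫ x, (x.2 i) ^ 2 ∂(μ (Nk k) T T)) / δ)
        (𝓝[≠] 0) (𝓝 (θk k i))) →
    (∀ k : ℕ, k ≤ xk k) → (∀ k : ℕ, xk k + k + 2 ≤ Nk k) →
    (∀ k : ℕ, (k : ℝ) * ∑ i : Fin (Nk k), ∑ j : Fin (Nk k),
        (if j.val = i.val + 1 ∧ xk k ≤ i.val + k ∧ i.val ≤ xk k + k then |θk k j - θk k i| else 0) <
      |dk k| / ((Nk k : ℝ) - 1)) →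
    ∃ (μinf : Measure ChainConfig) (Λ : (ChainConfig → ℝ) → ℝ),
      (pinnedChain ω₂ lam β γ).IsChainGibbsMeasure T μinf ∧ IsShiftInvariant μinf ∧
      (∀ (a : ℤ) (n : ℕ) (c₁ c₂ : ℝ) (g₁ g₂ : (Fin (n + 1) → ℝ × ℝ) → ℝ), Continuous g₁ → Continuous g₂ →
        (∃ (C₀ : ℝ) (m : ℕ), ∀ y, |g₁ y| ≤ C₀ * (1 + ‖y‖) ^ m ∧ |g₂ y| ≤ C₀ * (1 + ‖y‖) ^ m) →
        Λ ((fun y => c₁ * g₁ y + c₂ * g₂ y) ∘ boxRestrictAt a n) =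
          c₁ * Λ (g₁ ∘ boxRestrictAt a n) + c₂ * Λ (g₂ ∘ boxRestrictAt a n)) ∧
      (∃ A : ℝ, ∀ (n : ℕ) (a : ℤ) (g : (Fin (n + 1) → ℝ × ℝ) → ℝ), Continuous g →
        (∃ (C₀ : ℝ) (m : ℕ), ∀ y, |g y| ≤ C₀ * (1 + ‖y‖) ^ m) →
        |Λ (g ∘ boxRestrictAt a n)| ≤
          A * Real.sqrt ((n : ℝ) + 1) * Real.sqrt (∫ σ, (g (boxRestrictAt a n σ)) ^ 2 ∂μinf)) ∧
      (∀ (a : ℤ) (n : ℕ) (G : (Fin (n + 1) → ℝ × ℝ) → ℝ), ContDiff ℝ 1 G →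
        (∃ (C₀ : ℝ) (m : ℕ), ∀ y, |G y| ≤ C₀ * (1 + ‖y‖) ^ m ∧ ‖fderiv ℝ G y‖ ≤ C₀ * (1 + ‖y‖) ^ m) →
        Λ (liouvilleZ (pinnedChain ω₂ lam β γ) (G ∘ boxRestrictAt a n)) = 0) ∧
      (∀ i : ℤ, Λ (fun σ => (pinnedChain ω₂ lam β γ).bondCurrentZ σ i) = 1) := by
  intro ω₂ lam β γ hω hl hβ hγ hU μ hμ T hT hA Nk dk θk xk hD hΘ hx₁ hx₂ hlt
  obtain ⟨μinf, hG, hS, hb1, hb1', hb2b, hb2c, hb3, hb4⟩ :=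
    equilibriumPackageWeak ω₂ lam β γ hω hl hβ hγ T hT
  obtain ⟨Λ, h⟩ := stub_softExtractionWeakSqrt ω₂ lam β γ hω hl hβ hγ hU μ hμ T hT hA
    (stub_finiteResponsePackage ω₂ lam β γ hω hl hβ hγ hU μ hμ T hT) μinf hG hS hb1 hb1' hb2b hb2c
    hb3 hb4 Nk dk θk xk hD hΘ hx₁ hx₂ hlt
  exact ⟨μinf, Λ, hG, hS, h⟩

/-- **`LocalOhm` from the interior LTE estimate at the CLT scale and variational zero current Drude weight** (the glue of the
reshaped birth line): if (S1♯) holds and (VZD) holds for every shift-invariant Gibbs state of the infinite chain, then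
`LocalOhmBV.LocalOhm`. Proof: if no `(C, ℓ, b)` works, the diagonal choice `C = ℓ = b = k` gives a violating sequence; `blowUpLimitSqrt`
produces a `√n`-regular bad functional with unit current; the landed bridge `stub_noUnitCurrent_of_zeroDrudeVar` fed with (VZD) says no
such functional exists. Both hypotheses are of open-problem strength; this theorem records that NOTHING ELSE is needed. [folklore] -/
theorem localOhm_of_linearisedLTESharp_of_zeroDrudeVar :
    (∀ ω₂ lam β γ : ℝ, 0 < ω₂ → 0 < lam → 0 < β → 0 < γ →
    (∀ (N : ℕ) (T_L T_R : ℝ), 0 < T_L → 0 < T_R → ∀ μ ν : Measure (PhaseSpace N),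
      (pinnedChain ω₂ lam β γ).IsSteadyState N T_L T_R μ →
      (pinnedChain ω₂ lam β γ).IsSteadyState N T_L T_R ν → μ = ν) →
    ∀ μ : (N : ℕ) → ℝ → ℝ → Measure (PhaseSpace N),
    (∀ (N : ℕ) (T_L T_R : ℝ), 0 < T_L → 0 < T_R →
      (pinnedChain ω₂ lam β γ).IsSteadyState N T_L T_R (μ N T_L T_R)) →
    ∀ T : ℝ, 0 < T →
    ∃ A : ℝ, ∀ ℓ : ℕ, ∃ b : ℕ, ∀ (N : ℕ) (d : ℝ) (θ : Fin N → ℝ),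
      Tendsto (fun δ : ℝ => (pinnedChain ω₂ lam β γ).totalCurrent (μ N (T + δ / 2) (T - δ / 2)) / δ)
        (𝓝[≠] 0) (𝓝 d) →
      (∀ i : Fin N, Tendsto (fun δ : ℝ => ((∫ x, (x.2 i) ^ 2 ∂(μ N (T + δ / 2) (T - δ / 2))) -
        ∫ x, (x.2 i) ^ 2 ∂(μ N T T)) / δ) (𝓝[≠] 0) (𝓝 (θ i))) →
      ∀ x : ℕ, b + ℓ ≤ x → x + ℓ + b + 2 ≤ N →
      ∀ ψ : PhaseSpace N → ℝ, Continuous ψ →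
        (∀ z z' : PhaseSpace N, (∀ i : Fin N, x ≤ i.val + ℓ → i.val ≤ x + ℓ + 1 →
          z.1 i = z'.1 i ∧ z.2 i = z'.2 i) → ψ z = ψ z') →
        (∃ (C₀ : ℝ) (m : ℕ), ∀ z, |ψ z| ≤ C₀ * (1 + ‖z‖) ^ m) →
        ∀ ρ : ℝ, Tendsto (fun δ : ℝ => ((∫ z, ψ z ∂(μ N (T + δ / 2) (T - δ / 2))) -
          ∫ z, ψ z ∂(μ N T T)) / δ) (𝓝[≠] 0) (𝓝 ρ) →
        |ρ - (∑ i : Fin N, if i.val = x then θ i else 0) *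
            (((∫ z, ψ z * (pinnedChain ω₂ lam β γ).hamiltonian N z ∂(μ N T T)) -
              (∫ z, ψ z ∂(μ N T T)) * (∫ z, (pinnedChain ω₂ lam β γ).hamiltonian N z ∂(μ N T T))) /
              T ^ 2)| ≤
          A * Real.sqrt ((ℓ : ℝ) + 1) * Real.sqrt (∫ z, (ψ z) ^ 2 ∂(μ N T T)) *
            (|d| / ((N : ℝ) - 1) + ∑ i : Fin N, ∑ j : Fin N,
              (if j.val = i.val + 1 ∧ x ≤ i.val + ℓ ∧ i.val ≤ x + ℓ then |θ j - θ i| else 0))) →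
    (∀ ω₂ lam β γ : ℝ, 0 < ω₂ → 0 < lam → 0 < β → 0 < γ → ∀ T : ℝ, 0 < T →
    ∀ μinf : Measure ChainConfig, (pinnedChain ω₂ lam β γ).IsChainGibbsMeasure T μinf →
    IsShiftInvariant μinf →
    ∀ ε : ℝ, 0 < ε → ∃ (a : ℤ) (n : ℕ) (G E : (Fin (n + 1) → ℝ × ℝ) → ℝ),
      ContDiff ℝ 1 G ∧
      (∃ (C₀ : ℝ) (m : ℕ), ∀ y, |G y| ≤ C₀ * (1 + ‖y‖) ^ m ∧ ‖fderiv ℝ G y‖ ≤ C₀ * (1 + ‖y‖) ^ m) ∧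
      Continuous E ∧ (∃ (C₀ : ℝ) (m : ℕ), ∀ y, |E y| ≤ C₀ * (1 + ‖y‖) ^ m) ∧
      (∀ y, E (fun i => ((y i).1, -(y i).2)) = E y) ∧
      ∀ M₀ : ℕ, ∃ M : ℕ, M₀ ≤ M ∧
        (∫ σ, (∑ x ∈ Finset.range (M + 1),
            ((pinnedChain ω₂ lam β γ).bondCurrentZ σ (x : ℤ) -
              liouvilleZ (pinnedChain ω₂ lam β γ) (G ∘ boxRestrictAt (a + (x : ℤ)) n) σ -
              E (boxRestrictAt (a + (x : ℤ)) n σ))) ^ 2 ∂μinf) ≤ ε * ((M : ℝ) + 1)) →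
    Summit.AtomisticToContinuum.FouriersLaw.Theses.LocalOhmBV.LocalOhm := by
  intro hS1 hVZD ω₂ lam β γ hω hl hβ hγ hU μ hμ T hT
  by_contra hneg
  -- with `C = ℓ = b = k` the local Ohm inequality fails at some bulk bond, for every `k`
  have hk : ∀ k : ℕ, ∃ (N : ℕ) (d : ℝ) (θ : Fin N → ℝ),
      Tendsto (fun δ : ℝ => (pinnedChain ω₂ lam β γ).totalCurrent (μ N (T + δ / 2) (T - δ / 2)) / δ)
        (𝓝[≠] 0) (𝓝 d) ∧
      (∀ i : Fin N, Tendsto (fun δ : ℝ => ((∫ x, (x.2 i) ^ 2 ∂(μ N (T + δ / 2) (T - δ / 2))) -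
        ∫ x, (x.2 i) ^ 2 ∂(μ N T T)) / δ) (𝓝[≠] 0) (𝓝 (θ i))) ∧
      ∃ x : ℕ, k ≤ x ∧ x + k + 2 ≤ N ∧
        (k : ℝ) * ∑ i : Fin N, ∑ j : Fin N,
            (if j.val = i.val + 1 ∧ x ≤ i.val + k ∧ i.val ≤ x + k then |θ j - θ i| else 0) <
          |d| / ((N : ℝ) - 1) := by
    intro k
    by_contra hk'
    push Not at hk'
    exact hneg ⟨(k : ℝ), k, k, fun N d θ hd hθ x hx₁ hx₂ => hk' N d θ hd hθ x hx₁ hx₂⟩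
  choose Nk dk θk hD hΘ xk hx₁ hx₂ hlt using hk
  -- blow-up in the `√n` class: a bad first-order functional on the infinite chain
  obtain ⟨μinf, Λ, hGibbs, hshift, hlin, hbd, hinv, hcur⟩ :=
    blowUpLimitSqrt ω₂ lam β γ hω hl hβ hγ hU μ hμ T hT
      (hS1 ω₂ lam β γ hω hl hβ hγ hU μ hμ T hT) Nk dk θk xk hD hΘ hx₁ hx₂ hlt
  -- rigidity: variational zero current Drude weight at `μinf`, through the landed bridge
  exact stub_noUnitCurrent_of_zeroDrudeVar ω₂ lam β γ hω hl hβ hγ T hT μinf hGibbs hshift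
    (hVZD ω₂ lam β γ hω hl hβ hγ T hT μinf hGibbs hshift) Λ hlin hbd hinv hcur

/-- The shared copy: (S1♯) → (VZD) → `TransferKernelPositivity.LocalOhm` (the two route decls are definitionally equal). [folklore] -/
theorem transferKernelPositivity_localOhm_of_linearisedLTESharp_of_zeroDrudeVar
    (hS1 : ∀ ω₂ lam β γ : ℝ, 0 < ω₂ → 0 < lam → 0 < β → 0 < γ →
    (∀ (N : ℕ) (T_L T_R : ℝ), 0 < T_L → 0 < T_R → ∀ μ ν : Measure (PhaseSpace N),
      (pinnedChain ω₂ lam β γ).IsSteadyState N T_L T_R μ →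
      (pinnedChain ω₂ lam β γ).IsSteadyState N T_L T_R ν → μ = ν) →
    ∀ μ : (N : ℕ) → ℝ → ℝ → Measure (PhaseSpace N),
    (∀ (N : ℕ) (T_L T_R : ℝ), 0 < T_L → 0 < T_R →
      (pinnedChain ω₂ lam β γ).IsSteadyState N T_L T_R (μ N T_L T_R)) →
    ∀ T : ℝ, 0 < T →
    ∃ A : ℝ, ∀ ℓ : ℕ, ∃ b : ℕ, ∀ (N : ℕ) (d : ℝ) (θ : Fin N → ℝ),
      Tendsto (fun δ : ℝ => (pinnedChain ω₂ lam β γ).totalCurrent (μ N (T + δ / 2) (T - δ / 2)) / δ)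
        (𝓝[≠] 0) (𝓝 d) →
      (∀ i : Fin N, Tendsto (fun δ : ℝ => ((∫ x, (x.2 i) ^ 2 ∂(μ N (T + δ / 2) (T - δ / 2))) -
        ∫ x, (x.2 i) ^ 2 ∂(μ N T T)) / δ) (𝓝[≠] 0) (𝓝 (θ i))) →
      ∀ x : ℕ, b + ℓ ≤ x → x + ℓ + b + 2 ≤ N →
      ∀ ψ : PhaseSpace N → ℝ, Continuous ψ →
        (∀ z z' : PhaseSpace N, (∀ i : Fin N, x ≤ i.val + ℓ → i.val ≤ x + ℓ + 1 →
          z.1 i = z'.1 i ∧ z.2 i = z'.2 i) → ψ z = ψ z') →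
        (∃ (C₀ : ℝ) (m : ℕ), ∀ z, |ψ z| ≤ C₀ * (1 + ‖z‖) ^ m) →
        ∀ ρ : ℝ, Tendsto (fun δ : ℝ => ((∫ z, ψ z ∂(μ N (T + δ / 2) (T - δ / 2))) -
          ∫ z, ψ z ∂(μ N T T)) / δ) (𝓝[≠] 0) (𝓝 ρ) →
        |ρ - (∑ i : Fin N, if i.val = x then θ i else 0) *
            (((∫ z, ψ z * (pinnedChain ω₂ lam β γ).hamiltonian N z ∂(μ N T T)) -
              (∫ z, ψ z ∂(μ N T T)) * (∫ z, (pinnedChain ω₂ lam β γ).hamiltonian N z ∂(μ N T T))) /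
              T ^ 2)| ≤
          A * Real.sqrt ((ℓ : ℝ) + 1) * Real.sqrt (∫ z, (ψ z) ^ 2 ∂(μ N T T)) *
            (|d| / ((N : ℝ) - 1) + ∑ i : Fin N, ∑ j : Fin N,
              (if j.val = i.val + 1 ∧ x ≤ i.val + ℓ ∧ i.val ≤ x + ℓ then |θ j - θ i| else 0)))
    (hVZD : ∀ ω₂ lam β γ : ℝ, 0 < ω₂ → 0 < lam → 0 < β → 0 < γ → ∀ T : ℝ, 0 < T →
    ∀ μinf : Measure ChainConfig, (pinnedChain ω₂ lam β γ).IsChainGibbsMeasure T μinf →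
    IsShiftInvariant μinf →
    ∀ ε : ℝ, 0 < ε → ∃ (a : ℤ) (n : ℕ) (G E : (Fin (n + 1) → ℝ × ℝ) → ℝ),
      ContDiff ℝ 1 G ∧
      (∃ (C₀ : ℝ) (m : ℕ), ∀ y, |G y| ≤ C₀ * (1 + ‖y‖) ^ m ∧ ‖fderiv ℝ G y‖ ≤ C₀ * (1 + ‖y‖) ^ m) ∧
      Continuous E ∧ (∃ (C₀ : ℝ) (m : ℕ), ∀ y, |E y| ≤ C₀ * (1 + ‖y‖) ^ m) ∧
      (∀ y, E (fun i => ((y i).1, -(y i).2)) = E y) ∧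
      ∀ M₀ : ℕ, ∃ M : ℕ, M₀ ≤ M ∧
        (∫ σ, (∑ x ∈ Finset.range (M + 1),
            ((pinnedChain ω₂ lam β γ).bondCurrentZ σ (x : ℤ) -
              liouvilleZ (pinnedChain ω₂ lam β γ) (G ∘ boxRestrictAt (a + (x : ℤ)) n) σ -
              E (boxRestrictAt (a + (x : ℤ)) n σ))) ^ 2 ∂μinf) ≤ ε * ((M : ℝ) + 1)) :
    Summit.AtomisticToContinuum.FouriersLaw.Theses.TransferKernelPositivity.LocalOhm :=
  localOhm_of_linearisedLTESharp_of_zeroDrudeVar hS1 hVZD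

end Summit.AtomisticToContinuum.FouriersLaw.Theorems.LocalOhmBirth

end
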